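import Summits.NavierStokesRegularity.NavierStokesRegularity.Theorems.AxisymmetricExtremalityAxisymmetricKatoGlobalStubSeregin2020TypeIILemma22ParabolicBumpIntegrals
import Summits.NavierStokesRegularity.NavierStokesRegularity.Theorems.AxisymmetricExtremalityAxisymmetricKatoGlobalStubSeregin2020TypeIILemma22DriftCommutator
import HarnessLib

/-!
# Seregin 2020, Lemma 2.2 (after Nazarov–Uraltseva 2012): the cost of excising one parabolic
# cylinder from the very weak form — drift and axis-drift terms, and bookkeeping lemmas

Helper toward the stub `stub_seregin2020TypeII` of the crux `AxisymmetricKatoGlobal` (= the named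
fact `Literature.Analysis.FluidPDE.Seregin2020_axisymmetricSingularPoint_typeII`, G. Seregin,
Anal. Math. Phys. 10 (2020) Paper 46 = arXiv:2006.04140, Thm 2.1), reduced in the tree to the
corrected Lemma 2.2 (`hWH′`; Nazarov–Uraltseva 2012, Lemma 4.2 for the class 𝒱). The very weak
form (N–U (4.5)) is tested against `η₀ · G(∑ᵢ ψᵢ)` (siblings `…Lemma22ExcisionCutoff`,
`…Lemma22ParabolicBumps`); the error of the excision is a sum over the bumps of integrals of
`|∂ₜψᵢ|`, `|Δψᵢ|`, `‖Dψᵢ‖` (sibling `…Lemma22ParabolicBumpIntegrals`) and of the two drift terms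
treated here, for a bump of radius `0 < r < 1` with the derivative constant `A`:

* `integral_norm_mul_norm_fderiv_bump_le` — `∫∫_K ‖U‖ ‖Dψ‖ ≤ A (∫∫_K ‖U‖³ + 135) r`
  (pointwise `u/r ≤ u³ r + r⁻²` for `u ≥ 0`, `0 < r < 1`; no Hölder, no multiplicity);
* `integral_inv_cylRadius_mul_norm_fderiv_bump_le` — `∫∫ ϱ⁻¹ ‖Dψ‖ ≤ A C_ax r`
  (`∫∫_box ϱ⁻¹ ≤ C_ax r⁴`);
* `neg_integral_le_integral_of_le` — `-∫ f ≤ ∫ g` whenever `-f ≤ g` a.e. with `g ≥ 0`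
  integrable (whether or not `f` is integrable), the form in which the four terms of the very weak
  inequality are bounded;
* `aestronglyMeasurable_indicator_of_continuousOn_offAxis_real` — scalar twin of the tree's
  measurability lemma for fields continuous off the axis.

## References

* G. Seregin, Anal. Math. Phys. 10 (2020), Paper 46 = arXiv:2006.04140, Lemma 2.2, class 𝒱 (i)
  (arXiv p. 8). [Seregin2020]
* A. I. Nazarov, N. N. Uraltseva, St. Petersburg Math. J. 23 (2012) 93–115 = arXiv:1011.1888,
  proof of Lemma 4.2, (4.5)–(4.6). [NazarovUraltseva2012]
-/

-- the problem directory repeats the summit name (D-0017); core's `dupNamespace` linter fires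
set_option linter.dupNamespace false

noncomputable section

open MeasureTheory Set Function Filter Topology TopologicalSpace Metric
open scoped NNReal ENNReal InnerProductSpace Laplacian

namespace Summit.NavierStokesRegularity.NavierStokesRegularity.Theorems.AxisymmetricKatoGlobal.EulerScaling

open Literature.Analysis.FluidPDE

/-! ### Bookkeeping -/

/-- **`-∫ f ≤ ∫ g` from `-f ≤ g` a.e., `0 ≤ g` a.e., `g` integrable** — also when `f` is not
integrable (then `∫ f = 0 ≤ ∫ g`). [folklore] -/
theorem neg_integral_le_integral_of_le {α : Type*} [MeasurableSpace α] {μ : Measure α} {f g : α → ℝ}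
    (hg : Integrable g μ) (hg0 : 0 ≤ᵐ[μ] g) (hfg : ∀ᵐ a ∂μ, -f a ≤ g a) :
    -∫ a, f a ∂μ ≤ ∫ a, g a ∂μ := by
  by_cases hf : Integrable f μ
  · rw [← integral_neg]
    exact integral_mono_ae hf.neg hg hfg
  · rw [integral_undef hf, neg_zero]
    exact integral_nonneg_of_ae hg0

/-- The elementary inequality behind the drift cost: `u / r ≤ u³ r + r⁻²` for `u ≥ 0`,
`r > 0`. [folklore] -/
theorem div_le_cube_mul_add_inv_sq {u r : ℝ} (hu : 0 ≤ u) (hr : 0 < r) :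
    u / r ≤ u ^ 3 * r + (r ^ 2)⁻¹ := by
  rcases le_or_gt (r⁻¹) u with h | h
  · -- `u ≥ 1/r`: `u² ≥ 1/r²`, so `u³ r ≥ u / r`
    have h1 : r⁻¹ * r⁻¹ ≤ u * u := mul_le_mul h h (inv_nonneg.2 hr.le) hu
    have : u / r ≤ u ^ 3 * r := by
      rw [div_le_iff₀ hr]
      have e : u ^ 3 * r * r = u * (u * u) * (r * r) := by ring
      rw [e]
      have h2 : u * (r⁻¹ * r⁻¹) * (r * r) ≤ u * (u * u) * (r * r) :=
        mul_le_mul_of_nonneg_right (mul_le_mul_of_nonneg_left h1 hu) (by positivity)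
      have e2 : u * (r⁻¹ * r⁻¹) * (r * r) = u := by field_simp
      linarith
    linarith [inv_nonneg.2 (sq_nonneg r)]
  · -- `u < 1/r`: `u / r < 1/r²`
    have : u / r ≤ (r ^ 2)⁻¹ := by
      rw [div_le_iff₀ hr]
      calc u ≤ r⁻¹ := h.le
        _ = (r ^ 2)⁻¹ * r := by field_simp
    have h3 : 0 ≤ u ^ 3 * r := by positivity
    linarith

/-- **A scalar field continuous off the axis is measurable on compact sets** (scalar twin of
`aestronglyMeasurable_indicator_of_continuousOn_offAxis`; the axis is Lebesgue-null). [folklore] -/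
theorem aestronglyMeasurable_indicator_of_continuousOn_offAxis_real {W K : Set (ℝ × EuclideanSpace ℝ (Fin 3))}
    (hW : IsOpen W) (hK : IsCompact K) (hKW : K ⊆ W) {Φ : ℝ → EuclideanSpace ℝ (Fin 3) → ℝ}
    (hΦ : ContinuousOn (uncurry Φ) (W ∩ {z | cylRadius z.2 ≠ 0})) :
    AEStronglyMeasurable (K.indicator (uncurry Φ)) volume := by
  -- adapted from …Lemma22DriftCommutator (`aestronglyMeasurable_indicator_of_continuousOn_offAxis`)
  have hKm : MeasurableSet K := hK.isClosed.measurableSet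
  set O : Set (ℝ × EuclideanSpace ℝ (Fin 3)) := W ∩ {z | cylRadius z.2 ≠ 0} with hO
  have hOo : IsOpen O := hW.inter (isOpen_ne_fun (continuous_cylRadius.comp continuous_snd) continuous_const)
  have h1 : AEStronglyMeasurable (uncurry Φ) (volume.restrict O) := hΦ.aestronglyMeasurable hOo.measurableSet
  have h2 : AEStronglyMeasurable (uncurry Φ) (volume.restrict (K ∩ O)) :=
    h1.mono_measure (Measure.restrict_mono inter_subset_right le_rfl)
  have hae : K =ᵐ[volume] (K ∩ O : Set (ℝ × EuclideanSpace ℝ (Fin 3))) := by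
    rw [ae_eq_set]
    constructor
    · refine measure_mono_null (fun z hz => ?_) volume_setOf_cylRadius_snd_eq_zero
      by_contra h
      exact hz.2 ⟨hz.1, hKW hz.1, h⟩
    · exact measure_mono_null (fun z hz => (hz.2 hz.1.1).elim) (measure_empty (μ := volume))
  rw [aestronglyMeasurable_indicator_iff hKm, Measure.restrict_congr_set hae]
  exact h2

/-! ### The two drift costs of one bump -/

/-- **The drift cost of one bump**: for `K` compact, `‖U‖³` integrable on `K`, and a parabolic bump
`ψ` of radius `0 < r < 1` with derivative constant `A`:
`∫∫_K ‖U‖ ‖D_xψ‖ ≤ A (∫∫_K ‖U‖³ + 135) r`. [cite: NazarovUraltseva2012, proof of Lemma 4.2, the term ∫V|v||Dη| of (4.6)] -/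
theorem integral_norm_mul_norm_fderiv_bump_le {K : Set (ℝ × EuclideanSpace ℝ (Fin 3))} (hK : IsCompact K)
    {U : ℝ → EuclideanSpace ℝ (Fin 3) → EuclideanSpace ℝ (Fin 3)}
    (hU3 : IntegrableOn (fun z : ℝ × EuclideanSpace ℝ (Fin 3) => ‖U z.1 z.2‖ ^ 3) K)
    {r t₀ : ℝ} {x₀ : EuclideanSpace ℝ (Fin 3)} (hr : 0 < r) (hr1 : r < 1)
    {ψ : ℝ → EuclideanSpace ℝ (Fin 3) → ℝ}
    (hψ : ∀ t x, ψ t x = cutoff (r ^ 2) (t - t₀) * cutoff r (x - x₀)) {A : ℝ} (hA0 : 0 ≤ A)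
    (hA : ∀ (t : ℝ) (x : EuclideanSpace ℝ (Fin 3)),
      |deriv (fun s => ψ s x) t| ≤ A / r ^ 2 ∧ ‖fderiv ℝ (ψ t) x‖ ≤ A / r ∧ |(Δ (ψ t)) x| ≤ A / r ^ 2) :
    ∫ z in K, ‖U z.1 z.2‖ * ‖fderiv ℝ (ψ z.1) z.2‖ ≤
      A * ((∫ z in K, ‖U z.1 z.2‖ ^ 3) + 135) * r := by
  have hKm : MeasurableSet K := hK.isClosed.measurableSet
  set Bx : Set (ℝ × EuclideanSpace ℝ (Fin 3)) := Icc (t₀ - 2 * r ^ 2) (t₀ + 2 * r ^ 2) ×ˢ closedBall x₀ (2 * r) with hBx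
  have hBm : MeasurableSet Bx := measurableSet_Icc.prod measurableSet_closedBall
  have hBvol : volume Bx ≤ ENNReal.ofReal (135 * r ^ 5) := volume_parabolicBox_le hr t₀ x₀
  have hBfin : volume Bx < ∞ := hBvol.trans_lt ENNReal.ofReal_lt_top
  have hz := parabolicBump_derivs_eq_zero hr hψ
  -- the majorant `A (‖U‖³ r + r⁻²) 1_Bx`
  set g : ℝ × EuclideanSpace ℝ (Fin 3) → ℝ := fun z =>
    A * (‖U z.1 z.2‖ ^ 3 * r) + Bx.indicator (fun _ => A * (r ^ 2)⁻¹) z with hg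
  have hgi : Integrable g (volume.restrict K) := by
    refine ((hU3.mul_const r).const_mul A).add ?_
    exact ((integrableOn_const (C := A * (r ^ 2)⁻¹) hBfin.ne).integrable_indicator hBm).mono_measure
      Measure.restrict_le_self
  have hle : ∀ z, ‖U z.1 z.2‖ * ‖fderiv ℝ (ψ z.1) z.2‖ ≤ g z := by
    intro z
    by_cases hzB : z ∈ Bx
    · rw [hg]; simp only [indicator_of_mem hzB]
      have h1 : ‖U z.1 z.2‖ * ‖fderiv ℝ (ψ z.1) z.2‖ ≤ ‖U z.1 z.2‖ * (A / r) :=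
        mul_le_mul_of_nonneg_left (hA z.1 z.2).2.1 (norm_nonneg _)
      have h2 : ‖U z.1 z.2‖ * (A / r) = A * (‖U z.1 z.2‖ / r) := by ring
      have h3 := div_le_cube_mul_add_inv_sq (norm_nonneg (U z.1 z.2)) hr
      calc ‖U z.1 z.2‖ * ‖fderiv ℝ (ψ z.1) z.2‖ ≤ A * (‖U z.1 z.2‖ / r) := h1.trans_eq h2
        _ ≤ A * (‖U z.1 z.2‖ ^ 3 * r + (r ^ 2)⁻¹) := mul_le_mul_of_nonneg_left h3 hA0
        _ = A * (‖U z.1 z.2‖ ^ 3 * r) + A * (r ^ 2)⁻¹ := by ring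
    · have h0 : fderiv ℝ (ψ z.1) z.2 = 0 := (hz z.1 z.2 hzB).2.2.1
      rw [h0, norm_zero, mul_zero, hg]
      simp only [indicator_of_notMem hzB, add_zero]
      positivity
  refine (integral_mono_of_nonneg (Eventually.of_forall fun z => by positivity) hgi
    (Eventually.of_forall hle)).trans ?_
  rw [hg, integral_add ((hU3.mul_const r).const_mul A) (((integrableOn_const (C := A * (r ^ 2)⁻¹)
    hBfin.ne).integrable_indicator hBm).mono_measure Measure.restrict_le_self),
    integral_const_mul, integral_mul_const, integral_indicator hBm, setIntegral_const, smul_eq_mul]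
  -- `|K ∩ Bx| ≤ |Bx| ≤ 135 r⁵`
  have hvol : (volume.restrict K).real Bx ≤ 135 * r ^ 5 := by
    rw [measureReal_def, Measure.restrict_apply hBm]
    have := (measure_mono (Set.inter_subset_left (s := Bx) (t := K)) : volume (Bx ∩ K) ≤ volume Bx).trans hBvol
    have h := ENNReal.toReal_mono ENNReal.ofReal_ne_top this
    rwa [ENNReal.toReal_ofReal (by positivity)] at h
  have h5 : (volume.restrict K).real Bx * (A * (r ^ 2)⁻¹) ≤ 135 * r ^ 5 * (A * (r ^ 2)⁻¹) :=
    mul_le_mul_of_nonneg_right hvol (by positivity)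
  have e : 135 * r ^ 5 * (A * (r ^ 2)⁻¹) = A * 135 * r ^ 3 := by field_simp
  have hr3 : r ^ 3 ≤ r := by
    have := pow_le_pow_of_le_one hr.le hr1.le (by norm_num : 1 ≤ 3)
    rwa [pow_one] at this
  have hI0 : 0 ≤ ∫ z in K, ‖U z.1 z.2‖ ^ 3 := integral_nonneg fun z => by positivity
  nlinarith [mul_le_mul_of_nonneg_left hr3 (by positivity : 0 ≤ A * 135)]

/-- **The axis-drift cost of one bump**: with the absolute constant `C_ax` of
`exists_lintegral_inv_cylRadius_parabolicBox_le`, for a bump of radius `0 < r < 1` with derivative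
constant `A`: `∫∫ ϱ⁻¹ ‖D_xψ‖ ≤ A C_ax r`. [cite: NazarovUraltseva2012, proof of Lemma 4.2, the term ∫V|x'|⁻¹|Dη| of (4.6)] -/
theorem integral_inv_cylRadius_mul_norm_fderiv_bump_le {Cax : ℝ} (hCax0 : 0 ≤ Cax)
    (hCax : ∀ (r t₀ : ℝ) (x₀ : EuclideanSpace ℝ (Fin 3)), 0 < r →
      ∫⁻ z in Icc (t₀ - 2 * r ^ 2) (t₀ + 2 * r ^ 2) ×ˢ closedBall x₀ (2 * r),
        ENNReal.ofReal ((cylRadius z.2)⁻¹) ≤ ENNReal.ofReal (Cax * r ^ 4))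
    {r t₀ : ℝ} {x₀ : EuclideanSpace ℝ (Fin 3)} (hr : 0 < r) (hr1 : r < 1)
    {ψ : ℝ → EuclideanSpace ℝ (Fin 3) → ℝ}
    (hψ : ∀ t x, ψ t x = cutoff (r ^ 2) (t - t₀) * cutoff r (x - x₀)) {A : ℝ} (hA0 : 0 ≤ A)
    (hA : ∀ (t : ℝ) (x : EuclideanSpace ℝ (Fin 3)),
      |deriv (fun s => ψ s x) t| ≤ A / r ^ 2 ∧ ‖fderiv ℝ (ψ t) x‖ ≤ A / r ∧ |(Δ (ψ t)) x| ≤ A / r ^ 2) :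
    ∫ z : ℝ × EuclideanSpace ℝ (Fin 3), (cylRadius z.2)⁻¹ * ‖fderiv ℝ (ψ z.1) z.2‖ ≤ A * Cax * r := by
  set Bx : Set (ℝ × EuclideanSpace ℝ (Fin 3)) := Icc (t₀ - 2 * r ^ 2) (t₀ + 2 * r ^ 2) ×ˢ closedBall x₀ (2 * r) with hBx
  have hBm : MeasurableSet Bx := measurableSet_Icc.prod measurableSet_closedBall
  have hBc : IsCompact Bx := isCompact_Icc.prod (isCompact_closedBall _ _)
  have hz := parabolicBump_derivs_eq_zero hr hψ
  -- `ϱ⁻¹` is integrable on the compact box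
  have hρi : IntegrableOn (fun z : ℝ × EuclideanSpace ℝ (Fin 3) => (cylRadius z.2)⁻¹) Bx :=
    integrableOn_inv_cylRadius_snd hBc
  set g : ℝ × EuclideanSpace ℝ (Fin 3) → ℝ := Bx.indicator fun z => (cylRadius z.2)⁻¹ * (A / r) with hg
  have hgi : Integrable g := (integrable_indicator_iff hBm).2 (hρi.mul_const _)
  have hle : ∀ z : ℝ × EuclideanSpace ℝ (Fin 3), (cylRadius z.2)⁻¹ * ‖fderiv ℝ (ψ z.1) z.2‖ ≤ g z := by
    intro z
    by_cases hzB : z ∈ Bx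
    · rw [hg, indicator_of_mem hzB]
      exact mul_le_mul_of_nonneg_left (hA z.1 z.2).2.1 (inv_nonneg.2 (cylRadius_nonneg _))
    · rw [(hz z.1 z.2 hzB).2.2.1, norm_zero, mul_zero, hg, indicator_of_notMem hzB]
  refine (integral_mono_of_nonneg (Eventually.of_forall fun z => mul_nonneg (inv_nonneg.2 (cylRadius_nonneg _))
    (norm_nonneg _)) hgi (Eventually.of_forall hle)).trans ?_
  rw [hg, integral_indicator hBm, integral_mul_const]
  -- `∫_Bx ϱ⁻¹ ≤ C_ax r⁴`
  have hI : ∫ z in Bx, (cylRadius z.2)⁻¹ ≤ Cax * r ^ 4 := by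
    rw [integral_eq_lintegral_of_nonneg_ae (Eventually.of_forall fun z => inv_nonneg.2 (cylRadius_nonneg _))
      hρi.aestronglyMeasurable]
    have h := hCax r t₀ x₀ hr
    have h' := ENNReal.toReal_mono ENNReal.ofReal_ne_top h
    rwa [ENNReal.toReal_ofReal (by positivity)] at h'
  have hr4 : r ^ 4 ≤ r := by
    have := pow_le_pow_of_le_one hr.le hr1.le (by norm_num : 1 ≤ 4)
    rwa [pow_one] at this
  calc (∫ z in Bx, (cylRadius z.2)⁻¹) * (A / r) ≤ Cax * r ^ 4 * (A / r) :=
        mul_le_mul_of_nonneg_right hI (div_nonneg hA0 hr.le)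
    _ = A * Cax * r ^ 3 := by field_simp
    _ ≤ A * Cax * r := by
        have hr3 : r ^ 3 ≤ r := by
          have := pow_le_pow_of_le_one hr.le hr1.le (by norm_num : 1 ≤ 3)
          rwa [pow_one] at this
        exact mul_le_mul_of_nonneg_left hr3 (by positivity)

end Summit.NavierStokesRegularity.NavierStokesRegularity.Theorems.AxisymmetricKatoGlobal.EulerScaling

end
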